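import Summits.QuantumFields.YangMills.Theorems.BalabanUVNodesN15CurvedDressedPairExp
import Literature.Barriers.QuantumFields.NoClassicalGlueballsTraceForm
import HarnessLib

/-!
# Route «BalabanUVNodes» (cluster K4 «SpineRates»), Track-A DAG node N15 = NE2, BACKGROUND LAYER AT CURVED `U` — THE ORTHOGONALITY MODEL HOLDS FOR `𝔲(N)`-VALUED
# GAUGE FIELDS, EVERY `N`: in coordinates of `M_N(ℂ)` orthonormal for the real trace form `Re tr(XᴴY)` (they exist: the real and imaginary parts of the entries),
# `coordMat e (ad_B)` is SKEW for every skew-Hermitian `B`, so the exponential transports `coordMat e (e^{±η ad_{A_μ(x)}})` of dag-n15-c's FILE 28 and the transporter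
# fields of dag-n15-w3's curved lineage are ORTHOGONAL with no hypothesis left — the `SU(N)` programme's fibre (file 1 §5 did `ℍ ⊃ 𝔰𝔲(2)`)

Cell `pub-ymgap`, WIDTH SEAT `pub-ymgap-dag-n15-w2` (director-ym №197 ∕ HUMAN RULING D-0149), generation 2, file 3.  `bears_on: R4∕N15 · K3⁷ SpineGivenEndpointR13SepCoPH
(stmt-QuantumFields-20544)`.  Filed `--kind proof --supports stmt-QuantumFields-20544 --as helper` — COUNT-NEUTRAL; theorems only (0 `def`, 0 `sorry`, 0 `instance`; the
Frobenius normed-algebra structure on `M_N(ℂ)` is Mathlib's SCOPED one, `open scoped Matrix.Norms.Frobenius`, exactly as in the tree's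
`Literature.Barriers.QuantumFields.NoClassicalGlueballsTraceForm`); imports BY NAME this seat's file 2 `…N15CurvedDressedPairExp` (`hasMaj_curvDressed_sub_exp_of_skew`; through
it file 1 `…N15CurvedTransporterOrthogonality` p593011: `coordMat_adCLM_transpose_eq_neg_of_invariant`, `gaugeTransport_mul_transpose_of_skew`, `gaugeTransport_transpose_mul_of_skew`,
`expTrField_mul_transpose_of_skew`, `expTrField_transpose_mul_of_skew`, `expTrField_transpose_eq_of_skew`, `gaugeTransport_eq_gaugePair_of_skew`) and the barrier-catalogue file
`…NoClassicalGlueballsTraceForm`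
(`traceForm X Y = Re tr(XᴴY)`, `traceForm_eq_sum`, `traceForm_lie_left` — the `ad`-invariance of the trace form under skew-Hermitian letters [GlasseyStrauss1979 §3]); through
them dag-n15-c FILE 28 `gaugeTransport`, n15-w3 `expTrField` ∕ `gaugePair`, b2b `adCLM`; nothing re-declared.

WHY.  File 1 (p593011) reduced the orthogonality MODEL of the curved-`U` transporter-form lineage (n15-w3 files 1–5: `SSᵀ = 1`, `RᵀR = RRᵀ = 1`, `hRt`) to ONE algebraic
hypothesis — the generators' coordinate matrices `coordMat e (Z_μ(x))` are SKEW — and discharged it for the quaternions.  Bałaban's gauge fields are `𝔤`-valued with `𝔤` the Lie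
algebra of a compact group `G ⊂ U(N)` ([Balaban1985BackgroundPropagators] (3.37) p. 396: `U′ = exp(iηA′)`, `A′` with values in `𝔤`; the transports (3.50) p. 400 act by the
ADJOINT representation, `ad_{A′}`), i.e. `A_μ(x)` skew-Hermitian; the invariant inner product on `𝔲(N)` is (minus) the trace form, whose real extension to all of `M_N(ℂ)`,
`⟨X, Y⟩ = Re tr(XᴴY) = Σ_{ij}(Re X_{ij} Re Y_{ij} + Im X_{ij} Im Y_{ij})`, is `ad_B`-invariant for every skew-Hermitian `B` (cyclicity of the trace — the tree's
`traceForm_lie_left`).  THIS FILE closes the chain for EVERY `N`: orthonormal coordinates for the trace form exist (the `2N²` real coordinates `Re X_{ij}`, `Im X_{ij}`), in them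
`coordMat e (ad_B)` is skew for skew-Hermitian `B`, hence every exponential transport built from a `𝔲(N)`-valued field is orthogonal — the lineage's model hypothesis is a
THEOREM for the programme's fibre, not only for `ℍ`.

WHAT: ★ `coordMat_adCLM_transpose_eq_neg_of_conjTranspose` (trace-form-orthonormal `e`, `Bᴴ = −B` ⟹ `coordMat e (ad_B)` skew) · ★ `traceForm_exists_coords` (`∃ e : M_N(ℂ) ≃L[ℝ]
ℝ^{N×N×2}` with `traceForm X Y = e X ⬝ᵥ e Y` — the real∕imaginary parts of the entries) · `expTrField_mul_transpose_of_conjTranspose` ∕ `expTrField_transpose_mul_of_conjTranspose` ∕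
`expTrField_transpose_eq_of_conjTranspose` (n15-w3 files 1–5's `hS`, `hR'`, `hR`, `hRt` for generator fields `Z_μ(x) = ad_{A_μ(x)}`, `A` skew-Hermitian-valued) ·
`gaugeTransport_eq_gaugePair_of_conjTranspose` · ★★ `uN_gaugeTransport_orthogonal` (FILE 28's `U ≡ 1` transports of EVERY `𝔲(N)`-valued field are bondwise orthogonal, both
sides) · `suN_gaugeTransport_orthogonal` (the same for `𝔰𝔲(N)`-valued fields, `A_μ(x) ∈ suAlgebra N` — the tree's `Literature.MathematicalPhysics.QuantumFieldTheory.suAlgebra`) ·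
`suN_exists_coords_gaugeTransport_orthogonal` (existential form, nothing displayed) · §4 ★★ `uN_hasMaj_curvDressed_sub_exp` (END TO END: n15-w3 file 2's background-Lipschitz
increment NE2-LIP at a curved `U` for `𝔲(N)`-valued exponential data — perturbation `e^{η ad_A}`, background `e^{η ad_{W₀}}` — with NO model hypothesis: only generator letters,
regimes, the [B6] carrier, the (3.42)₀,₁-shaped majorants at `U` and the Neumann smallness remain, exactly the lineage's displayed DATA).

HONEST FRAMING ∕ LIMITS.  Finite-dimensional linear algebra (trace cyclicity, explicit coordinates) on top of file 1's exponential-series argument; REMOVES the last model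
hypothesis of the orthogonality chain for `𝔲(N)`∕`𝔰𝔲(N)`-valued data; proves NO estimate — the η-defects ∕ majorants of `G(U)`, the [B6] gluing, every (3.42)-shaped letter
stay where the lineage displays them; (3.37) p. 396 ∕ (3.50) p. 400 are cited as SHAPES (nothing of [B9] asserted).  NE2⁺ NOT PRINTED ∕ NOT proved for d = 4; N15 NOT
discharged; K3⁷ OPEN, not claimed; counts of record UNMOVED (typed 28∕28 · discharged 5∕27, A 5∕28); one finite 𝕋⁴ at fixed ε — NOT infinite volume, NOT OS on ℝ⁴, NOT a mass
gap, NOT Clay; R4 closes the conditional finite-𝕋⁴ rung `BalabanLadder.UV` only.  Restate-immune (no Theses import).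
-/

set_option autoImplicit false

noncomputable section
open scoped BigOperators Matrix Matrix.Norms.Frobenius
open Finset NormedSpace

namespace Summit.QuantumFields.YangMills.BalabanUVNodes.N15.CurvedSpecies

open Summit.QuantumFields.YangMills.BalabanUVNodes.N15.MatrixSpecies (Phi0 coordMat basisConst)
open Summit.QuantumFields.YangMills.BalabanUVNodes.N15.BackgroundLayer (gaugeTransport)
open Literature.MathematicalPhysics.QuantumFieldTheory.Balaban1983to89.Beta.AveragingCorrectionJets (adCLM adCLM_apply)
open Literature.MathematicalPhysics.QuantumFieldTheory (suAlgebra mem_suAlgebra_iff)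
open Literature.Barriers.QuantumFields (traceForm traceForm_eq_sum traceForm_lie_left)

variable {n : Type} [Fintype n] [DecidableEq n]

/-! ## §1 Skewness of `coordMat e (ad_B)` for skew-Hermitian `B` in trace-form-orthonormal coordinates -/

section Skew

/-- ★ **SKEW-HERMITIAN LETTER ⟹ SKEW COORDINATE MATRIX OF `ad`**: if the coordinates `e : M_N(ℂ) ≃L[ℝ] ℝ^κ` are ORTHONORMAL for the real trace form (`Re tr(XᴴY) = e X ⬝ᵥ e Y`)
and `Bᴴ = −B`, then `(coordMat e (ad_B))ᵀ = −coordMat e (ad_B)` — file 1's `coordMat_adCLM_transpose_eq_neg_of_invariant` with the `ad`-invariance `⟨[B,X], Y⟩ = −⟨X, [B,Y]⟩`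
of the trace form (the tree's `traceForm_lie_left`, cyclicity of the trace). [cite: Balaban1985BackgroundPropagators, (3.37) p.396, (3.50) p.400 (shape: 𝔤-valued `A′`, adjoint action)] -/
theorem coordMat_adCLM_transpose_eq_neg_of_conjTranspose {κ : Type} [Fintype κ] [DecidableEq κ] (e : Matrix n n ℂ ≃L[ℝ] (κ → ℝ))
    (he : ∀ X Y : Matrix n n ℂ, traceForm X Y = e X ⬝ᵥ e Y) {B : Matrix n n ℂ} (hB : Bᴴ = -B) :
    (coordMat e (adCLM ℝ B))ᵀ = -coordMat e (adCLM ℝ B) :=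
  coordMat_adCLM_transpose_eq_neg_of_invariant e (B := traceForm) he B fun X Y => by
    rw [← Ring.lie_def, ← Ring.lie_def]; exact traceForm_lie_left hB X Y

/-- The `𝔰𝔲(N)` letter case: `B ∈ suAlgebra N` (skew-Hermitian AND traceless) ⟹ `coordMat e (ad_B)` skew in trace-form-orthonormal coordinates. [folklore] -/
theorem coordMat_adCLM_transpose_eq_neg_of_mem_suAlgebra {N : ℕ} {κ : Type} [Fintype κ] [DecidableEq κ] (e : Matrix (Fin N) (Fin N) ℂ ≃L[ℝ] (κ → ℝ))
    (he : ∀ X Y : Matrix (Fin N) (Fin N) ℂ, traceForm X Y = e X ⬝ᵥ e Y) {B : Matrix (Fin N) (Fin N) ℂ} (hB : B ∈ suAlgebra N) :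
    (coordMat e (adCLM ℝ B))ᵀ = -coordMat e (adCLM ℝ B) :=
  coordMat_adCLM_transpose_eq_neg_of_conjTranspose e he ((mem_suAlgebra_iff B).mp hB).1

omit [DecidableEq n] in
/-- ★ **ORTHONORMAL COORDINATES FOR THE TRACE FORM EXIST**: `M_N(ℂ) ≃L[ℝ] ℝ^{n × n × 2}`, `X ↦ (Re X_{ij}, Im X_{ij})`, with `Re tr(XᴴY) = e X ⬝ᵥ e Y` (the tree's entrywise
formula `traceForm_eq_sum`; continuity by finite dimension) — so the hypothesis `he` of this file and of file 1 §4 is inhabited for every `N`. [folklore] -/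
theorem traceForm_exists_coords : ∃ e : Matrix n n ℂ ≃L[ℝ] (n × n × Fin 2 → ℝ), ∀ X Y : Matrix n n ℂ, traceForm X Y = e X ⬝ᵥ e Y := by
  let f : Matrix n n ℂ ≃ₗ[ℝ] (n × n × Fin 2 → ℝ) :=
    { toFun := fun X p => if p.2.2 = 0 then (X p.1 p.2.1).re else (X p.1 p.2.1).im
      invFun := fun v i j => ⟨v (i, j, 0), v (i, j, 1)⟩
      map_add' := fun X Y => by
        funext p; by_cases h : p.2.2 = 0 <;> simp [h, Matrix.add_apply]
      map_smul' := fun c X => by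
        funext p; by_cases h : p.2.2 = 0 <;> simp [h, Matrix.smul_apply]
      left_inv := fun X => by
        ext i j; simp
      right_inv := fun v => by
        funext p
        obtain ⟨i, j, k⟩ := p
        fin_cases k <;> simp }
  refine ⟨f.toContinuousLinearEquiv, fun X Y => ?_⟩
  rw [traceForm_eq_sum]
  simp only [LinearEquiv.coe_toContinuousLinearEquiv', dotProduct, Fintype.sum_prod_type, Fin.sum_univ_two]
  simp [f]

end Skew

/-! ## §2 The curved lineage's orthogonality hypotheses for `𝔲(N)`-valued generator fields -/

section Fields

variable {κ : Type} [Fintype κ] [DecidableEq κ] (e : Matrix n n ℂ ≃L[ℝ] (κ → ℝ)) {X J : Type} (η : ℝ) (τ : J → X ≃ X) (A : J → X → Matrix n n ℂ)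

/-- **`hS` ∕ `hR'` of n15-w3 files 1–4** for the exponential transporter field of a `𝔲(N)`-valued generator field `Z_μ(x) = ad_{A_μ(x)}` (`A_μ(x)ᴴ = −A_μ(x)`) in
trace-form-orthonormal coordinates: `S_μ(x)S_μ(x)ᵀ = 1`. [cite: Balaban1985BackgroundPropagators, (3.37) p.396, (3.50) p.400 (shape)] -/
theorem expTrField_mul_transpose_of_conjTranspose (he : ∀ X Y : Matrix n n ℂ, traceForm X Y = e X ⬝ᵥ e Y) (hA : ∀ μ x, (A μ x)ᴴ = -A μ x) (μ : J) (x : X) :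
    expTrField e η (fun μ x => adCLM ℝ (A μ x)) μ x * (expTrField e η (fun μ x => adCLM ℝ (A μ x)) μ x)ᵀ = 1 :=
  expTrField_mul_transpose_of_skew e η _ (fun μ x => coordMat_adCLM_transpose_eq_neg_of_conjTranspose e he (hA μ x)) μ x

/-- **`hR` of n15-w3 files 1–4** for a `𝔲(N)`-valued generator field: `R_μ(x)ᵀR_μ(x) = 1`. [cite: Balaban1985BackgroundPropagators, (3.37) p.396, (3.50) p.400 (shape)] -/
theorem expTrField_transpose_mul_of_conjTranspose (he : ∀ X Y : Matrix n n ℂ, traceForm X Y = e X ⬝ᵥ e Y) (hA : ∀ μ x, (A μ x)ᴴ = -A μ x) (μ : J) (x : X) :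
    (expTrField e η (fun μ x => adCLM ℝ (A μ x)) μ x)ᵀ * expTrField e η (fun μ x => adCLM ℝ (A μ x)) μ x = 1 :=
  expTrField_transpose_mul_of_skew e η _ (fun μ x => coordMat_adCLM_transpose_eq_neg_of_conjTranspose e he (hA μ x)) μ x

/-- **`hRt` of n15-w3 file 5** for a `𝔲(N)`-valued background generator field `W_μ(y) = ad_{A_μ(y)}`: the transpose IS the inverse transport,
`R_μ(y)ᵀ = coordMat e (Φ₀(η, −ad_{A_μ(y)}))`. [cite: Balaban1985BackgroundPropagators, (3.37) p.396, (3.50) p.400 (shape)] -/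
theorem expTrField_transpose_eq_of_conjTranspose (he : ∀ X Y : Matrix n n ℂ, traceForm X Y = e X ⬝ᵥ e Y) (hA : ∀ μ x, (A μ x)ᴴ = -A μ x) (μ : J) (y : X) :
    (expTrField e η (fun μ x => adCLM ℝ (A μ x)) μ y)ᵀ = coordMat e (Phi0 η (-(adCLM ℝ (A μ y)))) :=
  expTrField_transpose_eq_of_skew e η _ (fun μ x => coordMat_adCLM_transpose_eq_neg_of_conjTranspose e he (hA μ x)) μ y

/-- **dag-n15-c's two-sided `U ≡ 1` transports of a `𝔲(N)`-valued field READ AS n15-w3's `gaugePair`** of the forward exponential transporter field (file 1's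
`gaugeTransport_eq_gaugePair_of_skew`, skewness supplied). [cite: Balaban1985BackgroundPropagators, (3.50) p.400 (shape)] -/
theorem gaugeTransport_eq_gaugePair_of_conjTranspose (he : ∀ X Y : Matrix n n ℂ, traceForm X Y = e X ⬝ᵥ e Y) (hA : ∀ μ x, (A μ x)ᴴ = -A μ x) :
    gaugeTransport e τ η A = gaugePair τ (expTrField e η (fun μ x => adCLM ℝ (A μ x))) :=
  gaugeTransport_eq_gaugePair_of_skew e η τ A fun μ x => coordMat_adCLM_transpose_eq_neg_of_conjTranspose e he (hA μ x)

/-- ★★ **THE ORTHOGONALITY MODEL IS A THEOREM FOR `𝔲(N)`-VALUED GAUGE FIELDS, EVERY `N`**: in trace-form-orthonormal coordinates of `M_N(ℂ)` (they exist, `traceForm_exists_coords`),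
for EVERY field `A : J → X → M_N(ℂ)` with skew-Hermitian values and every `η`, dag-n15-c FILE 28's `U ≡ 1` gauge transports `coordMat e (e^{±η ad_{A_μ(x)}})` are bondwise
ORTHOGONAL on both sides — no hypothesis left beyond `A_μ(x)ᴴ = −A_μ(x)`. [cite: Balaban1985BackgroundPropagators, (3.37) p.396, (3.50) p.400 (shape)] -/
theorem uN_gaugeTransport_orthogonal (he : ∀ X Y : Matrix n n ℂ, traceForm X Y = e X ⬝ᵥ e Y) (hA : ∀ μ x, (A μ x)ᴴ = -A μ x) (b : J ⊕ J) (x : X) :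
    gaugeTransport e τ η A b x * (gaugeTransport e τ η A b x)ᵀ = 1 ∧ (gaugeTransport e τ η A b x)ᵀ * gaugeTransport e τ η A b x = 1 :=
  have hsk : ∀ μ x, (coordMat e (adCLM ℝ (A μ x)))ᵀ = -coordMat e (adCLM ℝ (A μ x)) := fun μ x =>
    coordMat_adCLM_transpose_eq_neg_of_conjTranspose e he (hA μ x)
  ⟨gaugeTransport_mul_transpose_of_skew e η τ A hsk b x, gaugeTransport_transpose_mul_of_skew e η τ A hsk b x⟩

end Fields

/-! ## §3 The `𝔰𝔲(N)` case by name (the tree's `suAlgebra N`) -/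

section SuN

variable {N : ℕ} {κ : Type} [Fintype κ] [DecidableEq κ] (e : Matrix (Fin N) (Fin N) ℂ ≃L[ℝ] (κ → ℝ)) {X J : Type} (η : ℝ) (τ : J → X ≃ X)
  (A : J → X → Matrix (Fin N) (Fin N) ℂ)

/-- ★★ **THE `𝔰𝔲(N)` PROGRAMME's FIBRE**: for EVERY `𝔰𝔲(N)`-valued gauge field (`A_μ(x) ∈ suAlgebra N`, the tree's `Literature.MathematicalPhysics.QuantumFieldTheory.suAlgebra`:
skew-Hermitian and traceless) the `U ≡ 1` gauge transports are bondwise orthogonal in trace-form-orthonormal coordinates — the orthogonality MODEL of the curved-`U` lineage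
holds for Bałaban's `SU(N)` lattice gauge fields with no hypothesis left. [cite: Balaban1985BackgroundPropagators, (3.37) p.396, (3.50) p.400 (shape)] -/
theorem suN_gaugeTransport_orthogonal (he : ∀ X Y : Matrix (Fin N) (Fin N) ℂ, traceForm X Y = e X ⬝ᵥ e Y) (hA : ∀ μ x, A μ x ∈ suAlgebra N) (b : J ⊕ J) (x : X) :
    gaugeTransport e τ η A b x * (gaugeTransport e τ η A b x)ᵀ = 1 ∧ (gaugeTransport e τ η A b x)ᵀ * gaugeTransport e τ η A b x = 1 :=
  uN_gaugeTransport_orthogonal e η τ A he (fun μ x => ((mem_suAlgebra_iff (A μ x)).mp (hA μ x)).1) b x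

/-- ★ **EXISTENTIAL FORM, NOTHING DISPLAYED**: for every `N` there ARE coordinates `e : M_N(ℂ) ≃L[ℝ] ℝ^{N×N×2}` in which the `U ≡ 1` transports of every `𝔰𝔲(N)`-valued gauge
field are bondwise orthogonal. [cite: Balaban1985BackgroundPropagators, (3.50) p.400 (shape)] -/
theorem suN_exists_coords_gaugeTransport_orthogonal (N : ℕ) :
    ∃ e : Matrix (Fin N) (Fin N) ℂ ≃L[ℝ] (Fin N × Fin N × Fin 2 → ℝ), ∀ {X J : Type} (η : ℝ) (τ : J → X ≃ X) (A : J → X → Matrix (Fin N) (Fin N) ℂ),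
      (∀ μ x, A μ x ∈ suAlgebra N) → ∀ (b : J ⊕ J) (x : X),
        gaugeTransport e τ η A b x * (gaugeTransport e τ η A b x)ᵀ = 1 ∧ (gaugeTransport e τ η A b x)ᵀ * gaugeTransport e τ η A b x = 1 := by
  obtain ⟨e, he⟩ := traceForm_exists_coords (n := Fin N)
  exact ⟨e, fun η τ A hA b x => suN_gaugeTransport_orthogonal e η τ A he hA b x⟩

end SuN

/-! ## §4 END TO END — NE2-LIP AT A CURVED `U` FOR `𝔲(N)`-VALUED EXPONENTIAL DATA WITH NO MODEL HYPOTHESIS: this seat's file 2 `hasMaj_curvDressed_sub_exp_of_skew`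
(p-landed `…N15CurvedDressedPairExp`) with the skewness SUPPLIED by §1 -/

section EndToEnd

open Literature.MathematicalPhysics.QuantumFieldTheory.Balaban1983to89
open Literature.MathematicalPhysics.QuantumFieldTheory.Balaban1983to89.B11SectG (BlockNorm HasMaj RowSum)
open Literature.MathematicalPhysics.QuantumFieldTheory.Balaban1983to89.B6RandomWalk (Triangle254)
open Summit.QuantumFields.YangMills.BalabanUVNodes.N15.MatrixSpecies (liftBlk)
open Summit.QuantumFields.YangMills.BalabanUVNodes.N15.BackgroundLayer (projO)

variable {κ : Type} [Fintype κ] [DecidableEq κ] (e : Matrix n n ℂ ≃L[ℝ] (κ → ℝ)) {X J : Type} [Fintype X] [DecidableEq X] [Fintype J] [DecidableEq J]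
  (η : ℝ) (τ : J → X ≃ X) (A W₀ : J → X → Matrix n n ℂ) {g : B6.Geometry} (blk : X → g.Site) (G : (X × κ → ℝ) →ₗ[ℝ] (X × κ → ℝ)) {β δ σ cr : ℝ}

/-- ★★ **THE BACKGROUND-LIPSCHITZ INCREMENT (NE2-LIP) AT A CURVED BASE POINT FOR `𝔲(N)`-VALUED EXPONENTIAL DATA, NO MODEL HYPOTHESIS**: perturbation
`S_μ(x) = coordMat e (e^{η ad_{A_μ(x)}})`, background `R_μ(x) = coordMat e (e^{η ad_{W₀,μ(x)}})` with `A`, `W₀` SKEW-HERMITIAN-valued (`𝔲(N)`), `e` trace-form-orthonormal;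
hypotheses left are exactly the lineage's DATA: generator letters `‖ad_{A_μ(x)}‖ ≤ r`, `‖ad_{W₀,μ(x)}‖ ≤ r_B`, lattice-gradient letter `‖ad_{A_μ(x)} − ad_{A_μ(x−e_μ)}‖ ≤ ηg`, regimes
`0 < η`, `ηr, ηr_B ≤ 1`, the [B6] carrier (`Triangle254`, `RowSum`, rates `ρ + σ ≤ δ`), the (3.42)₀,₁-shaped majorants of `G(U)` and of its covariant pieces AT the curved `U`
(the inductive datum) and the Neumann smallness — and the conclusion is file 2's verbatim: `pr₀X̂ − G(U) ≤ β·R_V·β(1 − β·R_V·c_r)⁻¹·c_r·e^{−ρd}`.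
[cite: Balaban1985BackgroundPropagators, (3.37) p.396 (shape), (3.63)–(3.65) pp.402–403 (mechanism), Thm 3.4 p.400] -/
theorem uN_hasMaj_curvDressed_sub_exp (he : ∀ X Y : Matrix n n ℂ, traceForm X Y = e X ⬝ᵥ e Y) (hA : ∀ μ x, (A μ x)ᴴ = -A μ x) (hW₀ : ∀ μ x, (W₀ μ x)ᴴ = -W₀ μ x)
    {r rB gZ ρ : ℝ} (htri : Triangle254 g) (hd : ∀ a b : g.Site, 0 ≤ g.dist a b) (hrow : RowSum g σ cr) (hσ : 0 ≤ σ)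
    (hρ : 0 ≤ ρ) (hρδ : ρ + σ ≤ δ) (hβ : 0 ≤ β) (hη : 0 < η) (hr : 0 ≤ r) (hrB : 0 ≤ rB) (hgZ : 0 ≤ gZ) (hreg : η * r ≤ 1) (hregB : η * rB ≤ 1)
    (hZ : ∀ μ x, ‖adCLM ℝ (A μ x)‖ ≤ r) (hW : ∀ μ x, ‖adCLM ℝ (W₀ μ x)‖ ≤ rB) (hgrad : ∀ μ x, ‖adCLM ℝ (A μ x) - adCLM ℝ (A μ ((τ μ).symm x))‖ ≤ η * gZ)
    (hG : HasMaj (BlockNorm.ofBlocks g (liftBlk blk κ)) (BlockNorm.ofBlocks g (liftBlk blk κ)) G (fun y y' => β * Real.exp (-(δ * g.dist y y'))))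
    (hD : ∀ j, HasMaj (BlockNorm.ofBlocks g (liftBlk blk κ)) (BlockNorm.ofBlocks g (liftBlk blk κ))
      (covPieces η τ (gaugePair τ (expTrField e η (fun μ x => adCLM ℝ (W₀ μ x)))) G j) (fun y y' => β * Real.exp (-(δ * g.dist y y'))))
    (hsmall : β * (curvRowLetter κ J (basisConst e * Real.exp 1 * r) (basisConst e * (Real.exp 1 * gZ + Real.exp 1 ^ 2 * (2 + Real.exp 1) * r * rB)) *
      (1 + Fintype.card (J ⊕ J))) * cr < 1) :
    HasMaj (BlockNorm.ofBlocks g (liftBlk blk κ)) (BlockNorm.ofBlocks g (liftBlk blk κ))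
      (projO none ∘ₗ curvDressed η τ (expTrField e η (fun μ x => adCLM ℝ (W₀ μ x))) (expTrField e η (fun μ x => adCLM ℝ (A μ x))) G - G)
      (fun y y' => β * ((curvRowLetter κ J (basisConst e * Real.exp 1 * r) (basisConst e * (Real.exp 1 * gZ + Real.exp 1 ^ 2 * (2 + Real.exp 1) * r * rB)) *
        (1 + Fintype.card (J ⊕ J))) * (β * (1 - β * (curvRowLetter κ J (basisConst e * Real.exp 1 * r)
          (basisConst e * (Real.exp 1 * gZ + Real.exp 1 ^ 2 * (2 + Real.exp 1) * r * rB)) * (1 + Fintype.card (J ⊕ J))) * cr)⁻¹)) * cr *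
        Real.exp (-(ρ * g.dist y y'))) :=
  hasMaj_curvDressed_sub_exp_of_skew e η τ (fun μ x => adCLM ℝ (A μ x)) (fun μ x => adCLM ℝ (W₀ μ x)) blk G htri hd hrow hσ hρ hρδ hβ hη hr hrB hgZ hreg hregB
    hZ hW hgrad (fun μ x => coordMat_adCLM_transpose_eq_neg_of_conjTranspose e he (hA μ x))
    (fun μ x => coordMat_adCLM_transpose_eq_neg_of_conjTranspose e he (hW₀ μ x)) hG hD hsmall

end EndToEnd

end Summit.QuantumFields.YangMills.BalabanUVNodes.N15.CurvedSpecies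

end
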